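import Summits.QuantumFields.YangMills.Theorems.BalabanUVNodesN22WindowSoftTwoPointAtRecord
import Summits.QuantumFields.YangMills.Theorems.BalabanUVNodesN27ReadOutAtU3OfKernels

/-!
# NODE N22 (NE9) — THE SOFT ROAD AT W1's ACTIVITY LEVEL, AT THE RECORD (complement): K3V5Defs' BILL LETTER ROWS `h9` ∕ `hW` LITERALLY
# (`hlim`-free), THE (D4) READ-OUT PIN FACE `ReadOutAt` IN ACTIVITY CURRENCY, and BOTH U3-side pin faces of `KeyedRatesHolderD4`'s body bundled

Cell `pub-ymgap`, Track A (HUMAN RULING D-0062), WIDTH SEAT `dag-n22-w2` (g4) on node n22 = NE9; `--kind proof --supports stmt-QuantumFields-20544 --as helper`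
(K3⁷ `SpineGivenEndpointR13SepCoPH`, skeleton v5 941dddb108cbaacf), COUNT-NEUTRAL; THEOREMS ONLY (0 `def`, 0 `sorry`, standard axioms).  Third record-level file of this
seat's lineage after (A) `…N22WindowSoftTwoPointAtSlots` (p605956) and (B) `…N22WindowSoftTwoPointAtRecord` (p606885), both g3.  (B) typed, from ACTIVITY-level located inputs,
K3⁷ v5 §2b's `h9` ∕ `hdec` and the N22 pin face `N22At (rateCarriersOfRecord₁₃CoPH 𝔯 …k).u3`; it did NOT type the OTHER U3-side conjunct of `KeyedRatesHolderD4`'s body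
(`K3V5Defs.keyedRatesHolderD4_rrOfRecord_iff`, dag-n27-w1 p606160: `RatesHolderAt … ∧ ReadOutAt … ∧ ρ-row`), the (D4) pin face `ReadOutAt`, which dag-n22-w5's p608801 §3
typed in PRINTED-slot currency only (`hAn` + holomorphic readings `hΦhol`).  This file closes that gap in ACTIVITY currency (the activity-holomorphy binder `hHhol` of (A)∕(B),
the road J32′ does not pass through) and spells K3V5Defs' Bill rows in their literal letter shapes.

WHAT.  §1 `windowedNE9OfRecord₁₃_letterRow_of_activitySlots` ∕ `windowedDecayOfRecord₁₃_letterRow_of_activitySlots`: the two W1-19b letters OF RECORD at the LETTER BLOCK's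
rate and moduli — `WindowedNE9OfRecord₁₃ F N θ ℓ.κ ℓ.moduli` and `WindowedDecayOfRecord₁₃ F N θ μ ν ℓ.κ` — i.e. LITERALLY the `h9` ∕ `hW` rows of dag-n27-w1's
`K3V5Defs.keyedRatesHolderD4_rrOfRecord_of_pins_of_letters` (there at `N := 2`, `(μ, ν) := (0, 1)`), from (B) §1's antecedent + `ℓ.Signs` + the DOMINATION rows `ℓ.κ ≤ δ₁`,
`C_9·Λ ≤ ℓ.moduli` ((A) §1b `windowedNE9_of_le` ∕ `windowedDecay_of_le`); NO `PolLimitsExistOfRecord₁₃` is read (the Bill takes it as its own row `hL`, supplied in this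
currency by dag-n22-w3 g3's `AtKernels.polLimitsExistOfRecord₁₃_of_activitySlots`, p607522).  §2 ★★★ `readOutAt_u3OfRecord₁₃_objectsOfRecord₁₃_of_activitySlots` ∕ ★★★
`readOutAt_rateCarriers_of_kernels_pin_of_activitySlots`: the (D4) PIN FACE — `ReadOutAt (datumOfRecord₁₃CoPH F N θ hP) (u3OfRecord₁₃ θ (objectsOfRecord₁₃ F N θ ℓ) k)` at the
OBJECTS ((Kf)'s currency) and `ReadOutAt (datumOfRecord₁₃CoPH F N θ hP) (rateCarriersOfRecord₁₃CoPH 𝔯 F θ hP g₀ os k).u3` at a reading PINNED to them (`hpin`, the `U3PinnedKernels`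
conjunct of v5's guard read at the tuple), for EVERY run length `k`: (B) §2 `kernelDecayOfRecord₁₃_of_activitySlots` at `(μ, ν, κ′) = (0, 1, ℓ.κ)` + the letter rows `0 < ℓ.κ`,
`betaPrime510 4 1 ℓ.κ ≤ ℓ.cr` fed to dag-n27-w1's `readOutAt_objectsOfRecord₁₃_coPH` (p591653; = K3⁷ v5 §2b `readOutAt_rrOfRecord_of_pinned` at the selector's value); `hlim :
PolLimitsExistOfRecord₁₃` DISPLAYED.  §3 `u3PinFaces_objectsOfRecord₁₃_of_activitySlots` ∕ `u3PinFaces_rateCarriers_of_kernels_pin_of_activitySlots`: BOTH U3-side conjuncts that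
(Kf) `pHolderD4Body_rateCarriers_of_kernels_pin` (dag-n27-w1, `…N27AtKernelPinnedReading13CoPHFSC`) reads — `N22At … ∧ ReadOutAt …` ∀ `k` — from ONE copy of the activity-slot antecedent.

HONEST FRAMING (binding).  Count-neutral COMPOSITION BY NAME of landed theorems (one monotonicity step, one application per face); NO estimate of Bałaban's is proved or asserted.
DISPLAYED (hypotheses), with owners: the towers∕reading with `Localizes17OfRecord₁₃` (the cluster expansion's content — NODE A ∕ N10), `Bound238`∕`YoungLipschitz` at the towers of record
(N10 ∕ NODE A; the differenced slot is NOT PRINTED — [I] p. 263 gives C^∞ «(or analytic)» in the LAST coupling only), activity holomorphy + the complexified minimizer reading `Φ` and its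
tails (NODE A ∕ N09; [I] p. 264, p. 282, [II] p. 15), `PolLimitsExistOfRecord₁₃` ([I] (1.21) p. 264; dag-n22-w3's road ⇐ (S≈)), numerals, the letter rows.  Nothing of the record is
constructed or claimed to meet them; (D4) and N22 are NOT discharged (typed 28∕28 · discharged 5∕27 UNCHANGED); K3⁷ OPEN and NOT claimed; NE9 NOT IN PRINT for d = 4; no count claim (the
chair's single count line is the only count); no summit statement is proved by this seat; one finite 𝕋⁴ programme at fixed ε — R4 closes the CONDITIONAL rung `BalabanLadder.UV` only;
NOTHING about the continuum limit, ℝ⁴, infinite volume, OS axioms, a mass gap or the Clay problem is proved or claimed by any of this.  References (TYPES only): [I] = Bałaban, CMP 109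
(1987) (1.7) p. 261, (1.18) p. 263, (1.20)–(1.21) p. 264, p. 282, (5.10) p. 293; [II] = CMP 116 (1988) (2.13)–(2.14) pp. 14–15, (2.38) p. 20.
-/

noncomputable section

open Filter Topology Metric Set
open scoped BigOperators

namespace YMDAG.N22.WindowSoftTwoPoint

open Literature.MathematicalPhysics.QuantumFieldTheory.Balaban1983to89
open Literature.MathematicalPhysics.QuantumFieldTheory.Balaban1983to89.T4Continuum (T4Family ULoop)
open Literature.MathematicalPhysics.QuantumFieldTheory.Balaban1983to89.T4OutputRate (Window NE9)
open Literature.MathematicalPhysics.QuantumFieldTheory.Balaban1983to89.Node00 (Stage13Params Stage13HParams U3Letters₁₁ MatA datumOfRecord₁₃CoPH)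
open Literature.MathematicalPhysics.QuantumFieldTheory.Balaban1983to89.Node00.Sect2 (domCount domSys CPair)
open Literature.MathematicalPhysics.QuantumFieldTheory.Balaban1983to89.Node00.LocalizedSum17 (ReadingMaps Localizes17OfRecord₁₃)
open Literature.MathematicalPhysics.QuantumFieldTheory.Balaban1983to89.Node00.W1 (ClusterTower ClusterStep)
open Literature.MathematicalPhysics.QuantumFieldTheory.Balaban1983to89.Node00.U3OfKernels (histPrefix objectsOfRecord₁₃ KernelDecayOfRecord₁₃)
open Literature.MathematicalPhysics.QuantumFieldTheory.Balaban1983to89.Node00.U3KernelLetters (WindowedNE9OfRecord₁₃ WindowedDecayOfRecord₁₃ PolLimitsExistOfRecord₁₃)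
open Literature.MathematicalPhysics.QuantumFieldTheory.Balaban1983to89.B12Decay510 (delta1)
open Literature.MathematicalPhysics.QuantumFieldTheory.Balaban1983to89.B12Decay510Window (K₁)
open Literature.MathematicalPhysics.QuantumFieldTheory.Balaban1983to89.B12Decay510Torus (distCT nearT)
open Literature.MathematicalPhysics.QuantumFieldTheory.Balaban1983to89.B12TreeDecay (K₀ kappa₀ K₀_pos)
open Literature.MathematicalPhysics.QuantumFieldTheory.Balaban1983to89.B12Sec2to5 (betaPrime510)
open Literature.MathematicalPhysics.QuantumFieldTheory.Balaban1983to89.TreeLengthTorus (TPt)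
open YMDAG.UVSplit (N22At ReadOutAt u3OfRecord₁₃ RateReading₁₃CoPH rateCarriersOfRecord₁₃CoPH)
open YMDAG.N22.AtKernels (n22At_u3OfRecord₁₃_objectsOfRecord₁₃_iff)
open Summit.QuantumFields.YangMills.BalabanUVNodes.N27ReadOutAtU3OfKernels (readOutAt_objectsOfRecord₁₃_coPH)

open scoped Matrix.Norms.L2Operator

variable (F : T4Family) (N : ℕ) [NeZero N]

/-! ## §1 K3V5Defs' Bill letter rows `h9` ∕ `hW` LITERALLY: the W1-19b letters of record at the letter block's rate and moduli (`hlim`-free) -/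

open Classical in
/-- **THE BILL's `h9` ROW FROM ACTIVITY-LEVEL SLOTS** (`hlim`-FREE): for a letter block `ℓ` with its signs DOMINATING the engine's constants — `ℓ.κ ≤ δ₁ = ½min{δ₀, κ(4M)⁻¹}` and
`C_9·Λ k i ≤ ℓ.moduli k i` (`ℓ.moduli k i = ℓ.C₉·ℓ.ω^{k−i}`) — the towers∕reading with `Localizes17OfRecord₁₃ F N θ S emb`, W1's `Bound238`∕`YoungLipschitz` at every tower and level on
prefix sets containing the cut histories of the window, Road 1's numerals, the complexified readings of the record's β-chart with holomorphic activities and the site weights with the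
minimizer tails give W1-19b's NE9-letter OF RECORD at the letters: `WindowedNE9OfRecord₁₃ F N θ ℓ.κ ℓ.moduli` — LITERALLY the `h9` row of dag-n27-w1's
`K3V5Defs.keyedRatesHolderD4_rrOfRecord_of_pins_of_letters` (there `N := 2`); (B) §1 `windowedNE9OfRecord₁₃_of_activitySlots` weakened by (A) §1b `windowedNE9_of_le`. -/
theorem windowedNE9OfRecord₁₃_letterRow_of_activitySlots (θ : Stage13Params F N) (ℓ : U3Letters₁₁) (hs : ℓ.Signs) (m' : ℕ) (M : ℕ) [NeZero M] (hM : M = F.L ^ m')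
    (S : (K : ℕ) → ClusterTower (F.P K) (MatA N) M) (emb : ReadingMaps F (MatA N) (MatA N)) (hloc : Localizes17OfRecord₁₃ F N θ S emb)
    (Wk : (K k : ℕ) → Set (Fin (k + 1) → ℝ)) (hWk : ∀ g ∈ Window θ.γ, ∀ K k, histPrefix g k ∈ Wk K k)
    (sp : (K k : ℕ) → (domSys (F.P K) M (k + 1)).Dom → Set (CPair (F.P K) (MatA N)))
    {A R r₁ κ δ₀ B₃ r : ℝ} (Λ : ℕ → ℕ → ℝ)
    (hA : 0 < A) (hr₁ : 0 ≤ r₁) (hκ : κ ≤ r₁) (hκ₀ : kappa₀ (4 * 2 ^ 4) (2 * 4) ≤ κ / 2) (hrate : r₁ + 2 * (64 * Real.log 162) + 2 ≤ R)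
    (hsmall : 2 * A * Real.exp (5 * r₁ + 1) * K₀ 64 8 * 9 * 64 ≤ 1) (hΛ : ∀ k i, 0 ≤ Λ k i) (hδ₀ : 0 < δ₀) (hB₃ : 0 ≤ B₃) (hr : 0 < r)
    (h238 : ∀ K k, ((S K) k).Bound238 (Wk K k) (sp K k) A R)
    (hYL : ∀ K k, ((S K) k).YoungLipschitz (Wk K k) (sp K k) (fun i : Fin (k + 1) => Λ (k + 1) i) R)
    (Ec : ℕ → ℕ → Type*) [∀ K k, NormedAddCommGroup (Ec K k)] [∀ K k, NormedSpace ℂ (Ec K k)]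
    (ι : letI := θ.instVβ₁; letI := θ.instVβ₂
      (K k : ℕ) → (domSys (F.P K) M (k + 1)).Dom → ((Fin (F.P K).d → Site (F.P K) (k + 1) → θ.Vβ) →L[ℝ] Ec K k))
    (Φ : (K k : ℕ) → (domSys (F.P K) M (k + 1)).Dom → Ec K k → CPair (F.P K) (MatA N))
    (U : (K k : ℕ) → (domSys (F.P K) M (k + 1)).Dom → Set (Ec K k)) (hU : ∀ K k X, IsOpen (U K k X)) (hrU : ∀ K k X, ball (0 : Ec K k) r ⊆ U K k X)
    (hHhol : ∀ g ∈ Window θ.γ, ∀ (K k : ℕ) (X Z : (domSys (F.P K) M (k + 1)).Dom), Z.1 ⊆ X.1 →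
      DifferentiableOn ℂ (fun z => ((S K) k).H (histPrefix g k) (Φ K k X z) Z) (U K k X))
    (hΦemb : letI := θ.instVβ₁; letI := θ.instVβ₂
      ∀ (K k : ℕ) (X : (domSys (F.P K) M (k + 1)).Dom) (B : Fin (F.P K).d → Site (F.P K) (k + 1) → θ.Vβ),
        Φ K k X (ι K k X B) = emb K k (fun l t => NormedSpace.exp (θ.ρ8 (B l t))))
    (hΦsp : ∀ (K k : ℕ) (X : (domSys (F.P K) M (k + 1)).Dom), ∀ z ∈ U K k X, ∀ Z : (domSys (F.P K) M (k + 1)).Dom, Z.1 ⊆ X.1 → Φ K k X z ∈ sp K k Z)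
    (w : (K k : ℕ) → (domSys (F.P K) M (k + 1)).Dom → Site (F.P K) (k + 1) → ℝ) (hw₀ : ∀ K k X t, 0 ≤ w K k X t)
    (hw : letI := θ.instVβ₁; letI := θ.instVβ₂; letI := θ.instιβ
      ∀ (K k : ℕ) (X : (domSys (F.P K) M (k + 1)).Dom) (l : Fin (F.P K).d) (t : Site (F.P K) (k + 1)) (c : θ.ιβ),
        ‖ι K k X (Pi.single l (Pi.single t (θ.bV c)))‖ ≤ w K k X t)
    (htail : ∀ (K k : ℕ) (X : (domSys (F.P K) M (k + 1)).Dom) (t : Site (F.P K) (k + 1)),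
      let e : Site (F.P K) (k + 1) → TPt 4 (domCount (F.P K) M (k + 1) * M) := fun x i => (ZMod.cast (x i) : ZMod (domCount (F.P K) M (k + 1) * M))
      w K k X t ≤ B₃ * Real.exp (-δ₀ * distCT (domCount (F.P K) M (k + 1)) M (e t) (nearT (M := M) (e t) X)))
    (hℓκ : ℓ.κ ≤ delta1 δ₀ κ ((M : ℝ) * 4))
    (hdom : ∀ k i, (16 * (8 * (Real.exp 1 * 9 * 64 * K₀ 64 8 ^ 2)) * B₃ ^ 2 / r ^ 2) *
        Real.exp (delta1 δ₀ κ ((M : ℝ) * 4) * ((M : ℝ) * 4) * 3) * K₀ (4 * 2 ^ 4) (2 * 4) * K₁ 4 (δ₀ / 2) * Λ k i ≤ ℓ.moduli k i) :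
    WindowedNE9OfRecord₁₃ F N θ ℓ.κ ℓ.moduli := by
  have h9 := windowedNE9OfRecord₁₃_of_activitySlots F N θ m' M hM S emb hloc Wk hWk sp Λ hA hr₁ hκ hκ₀ hrate hsmall hΛ hδ₀ hB₃ hr h238 hYL
    Ec ι Φ U hU hrU hHhol hΦemb hΦsp w hw₀ hw htail
  have hmod : ∀ k i, 0 ≤ ℓ.moduli k i := fun k i => by
    rw [U3Letters₁₁.moduli_apply]; exact mul_nonneg hs.C₉_nonneg (pow_nonneg hs.ω_nonneg _)
  letI := θ.instVβ₁; letI := θ.instVβ₂; letI := θ.instιβ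
  exact windowedNE9_of_le F _ θ.ρ8 θ.bV h9 hℓκ hdom hmod

open Classical in
/-- **THE BILL's `hW` ROW FROM ACTIVITY-LEVEL SLOTS** (`hlim`-FREE; value letter): for a letter block `ℓ` with `ℓ.κ ≤ δ₁`, the towers∕reading with `Localizes17OfRecord₁₃ F N θ S emb`,
W1's `Bound238` at every tower and level (`0 ≤ A`, single smallness), the complexified readings with holomorphic activities and the site weights with the minimizer tails give W1-19b's
(5.10) value letter OF RECORD at the letters' rate: `WindowedDecayOfRecord₁₃ F N θ μ ν ℓ.κ` for every `μ ν` — at `(μ, ν) := (0, 1)` LITERALLY the `hW` row of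
`K3V5Defs.keyedRatesHolderD4_rrOfRecord_of_pins_of_letters`; (B) §1 `windowedDecayOfRecord₁₃_of_activitySlots` weakened by (A) §1b `windowedDecay_of_le`. -/
theorem windowedDecayOfRecord₁₃_letterRow_of_activitySlots (θ : Stage13Params F N) (ℓ : U3Letters₁₁) (m' : ℕ) (M : ℕ) [NeZero M] (hM : M = F.L ^ m')
    (S : (K : ℕ) → ClusterTower (F.P K) (MatA N) M) (emb : ReadingMaps F (MatA N) (MatA N)) (hloc : Localizes17OfRecord₁₃ F N θ S emb)
    (Wk : (K k : ℕ) → Set (Fin (k + 1) → ℝ)) (hWk : ∀ g ∈ Window θ.γ, ∀ K k, histPrefix g k ∈ Wk K k)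
    (sp : (K k : ℕ) → (domSys (F.P K) M (k + 1)).Dom → Set (CPair (F.P K) (MatA N)))
    {A R r₁ κ δ₀ B₃ r : ℝ}
    (hA : 0 ≤ A) (hr₁ : 0 ≤ r₁) (hκ : κ ≤ r₁) (hκ₀ : kappa₀ (4 * 2 ^ 4) (2 * 4) ≤ κ / 2) (hrate : r₁ + 2 * (64 * Real.log 162) + 2 ≤ R)
    (hsmall : A * Real.exp (5 * r₁ + 1) * K₀ 64 8 * 9 * 64 ≤ 1) (hδ₀ : 0 < δ₀) (hB₃ : 0 ≤ B₃) (hr : 0 < r)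
    (h238 : ∀ K k, ((S K) k).Bound238 (Wk K k) (sp K k) A R)
    (Ec : ℕ → ℕ → Type*) [∀ K k, NormedAddCommGroup (Ec K k)] [∀ K k, NormedSpace ℂ (Ec K k)]
    (ι : letI := θ.instVβ₁; letI := θ.instVβ₂
      (K k : ℕ) → (domSys (F.P K) M (k + 1)).Dom → ((Fin (F.P K).d → Site (F.P K) (k + 1) → θ.Vβ) →L[ℝ] Ec K k))
    (Φ : (K k : ℕ) → (domSys (F.P K) M (k + 1)).Dom → Ec K k → CPair (F.P K) (MatA N))
    (U : (K k : ℕ) → (domSys (F.P K) M (k + 1)).Dom → Set (Ec K k)) (hU : ∀ K k X, IsOpen (U K k X)) (hrU : ∀ K k X, ball (0 : Ec K k) r ⊆ U K k X)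
    (hHhol : ∀ g ∈ Window θ.γ, ∀ (K k : ℕ) (X Z : (domSys (F.P K) M (k + 1)).Dom), Z.1 ⊆ X.1 →
      DifferentiableOn ℂ (fun z => ((S K) k).H (histPrefix g k) (Φ K k X z) Z) (U K k X))
    (hΦemb : letI := θ.instVβ₁; letI := θ.instVβ₂
      ∀ (K k : ℕ) (X : (domSys (F.P K) M (k + 1)).Dom) (B : Fin (F.P K).d → Site (F.P K) (k + 1) → θ.Vβ),
        Φ K k X (ι K k X B) = emb K k (fun l t => NormedSpace.exp (θ.ρ8 (B l t))))
    (hΦsp : ∀ (K k : ℕ) (X : (domSys (F.P K) M (k + 1)).Dom), ∀ z ∈ U K k X, ∀ Z : (domSys (F.P K) M (k + 1)).Dom, Z.1 ⊆ X.1 → Φ K k X z ∈ sp K k Z)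
    (w : (K k : ℕ) → (domSys (F.P K) M (k + 1)).Dom → Site (F.P K) (k + 1) → ℝ) (hw₀ : ∀ K k X t, 0 ≤ w K k X t)
    (hw : letI := θ.instVβ₁; letI := θ.instVβ₂; letI := θ.instιβ
      ∀ (K k : ℕ) (X : (domSys (F.P K) M (k + 1)).Dom) (l : Fin (F.P K).d) (t : Site (F.P K) (k + 1)) (c : θ.ιβ),
        ‖ι K k X (Pi.single l (Pi.single t (θ.bV c)))‖ ≤ w K k X t)
    (htail : ∀ (K k : ℕ) (X : (domSys (F.P K) M (k + 1)).Dom) (t : Site (F.P K) (k + 1)),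
      let e : Site (F.P K) (k + 1) → TPt 4 (domCount (F.P K) M (k + 1) * M) := fun x i => (ZMod.cast (x i) : ZMod (domCount (F.P K) M (k + 1) * M))
      w K k X t ≤ B₃ * Real.exp (-δ₀ * distCT (domCount (F.P K) M (k + 1)) M (e t) (nearT (M := M) (e t) X)))
    (hℓκ : ℓ.κ ≤ delta1 δ₀ κ ((M : ℝ) * 4)) (μ ν : Fin 4) :
    WindowedDecayOfRecord₁₃ F N θ μ ν ℓ.κ := by
  have hd := windowedDecayOfRecord₁₃_of_activitySlots F N θ m' M hM S emb hloc Wk hWk sp hA hr₁ hκ hκ₀ hrate hsmall hδ₀ hB₃ hr h238 Ec ι Φ U hU hrU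
    hHhol hΦemb hΦsp w hw₀ hw htail μ ν
  letI := θ.instVβ₁; letI := θ.instVβ₂; letI := θ.instιβ
  exact windowedDecay_of_le F _ θ.ρ8 θ.bV hd hℓκ

/-! ## §2 The (D4) READ-OUT pin face in activity currency: `ReadOutAt` at the kernel objects of record and at a reading pinned to them -/

open Classical in
/-- ★★★ **THE (D4) PIN FACE AT THE OBJECTS OF RECORD FROM ACTIVITY-LEVEL SLOTS + (1.21) EXISTENCE** ((Kf)'s currency, no reading binder): for a letter block `ℓ` with its signs,
`0 < ℓ.κ ≤ δ₁` and the read-out domination row `betaPrime510 4 1 ℓ.κ ≤ ℓ.cr`, the towers∕reading with `Localizes17OfRecord₁₃ F N θ S emb`, W1's value slot `Bound238` at every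
tower and level with Road 1's numerals, the complexified readings of the record's β-chart with holomorphic activities, the site weights with the minimizer tails and the displayed
(1.21) existence `PolLimitsExistOfRecord₁₃ F N θ` give `ReadOutAt (datumOfRecord₁₃CoPH F N θ hP) (u3OfRecord₁₃ θ (objectsOfRecord₁₃ F N θ ℓ) k)` for EVERY `k` — (B) §2
`kernelDecayOfRecord₁₃_of_activitySlots` at `(μ, ν, κ′) = (0, 1, ℓ.κ)` fed to dag-n27-w1's `readOutAt_objectsOfRecord₁₃_coPH` ((D4) at the pinned objects REDUCED to print's (5.10)
clause of record + the two letter rows).  LOCATED (hypothesis form); (D4) NOT discharged. -/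
theorem readOutAt_u3OfRecord₁₃_objectsOfRecord₁₃_of_activitySlots (θ : Stage13HParams F N) (hP : θ.Provisos₁₃CoPH F N) (ℓ : U3Letters₁₁) (hs : ℓ.Signs)
    (hℓ₀ : 0 < ℓ.κ) (hcr : betaPrime510 4 1 ℓ.κ ≤ ℓ.cr)
    (hlim : PolLimitsExistOfRecord₁₃ F N θ.toStage13Params) (m' : ℕ) (M : ℕ) [NeZero M] (hM : M = F.L ^ m')
    (S : (K : ℕ) → ClusterTower (F.P K) (MatA N) M) (emb : ReadingMaps F (MatA N) (MatA N)) (hloc : Localizes17OfRecord₁₃ F N θ.toStage13Params S emb)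
    (Wk : (K k : ℕ) → Set (Fin (k + 1) → ℝ)) (hWk : ∀ g ∈ Window θ.γ, ∀ K k, histPrefix g k ∈ Wk K k)
    (sp : (K k : ℕ) → (domSys (F.P K) M (k + 1)).Dom → Set (CPair (F.P K) (MatA N)))
    {A R r₁ κ δ₀ B₃ r : ℝ}
    (hA : 0 ≤ A) (hr₁ : 0 ≤ r₁) (hκ : κ ≤ r₁) (hκ₀ : kappa₀ (4 * 2 ^ 4) (2 * 4) ≤ κ / 2) (hrate : r₁ + 2 * (64 * Real.log 162) + 2 ≤ R)
    (hsmall : A * Real.exp (5 * r₁ + 1) * K₀ 64 8 * 9 * 64 ≤ 1) (hδ₀ : 0 < δ₀) (hB₃ : 0 ≤ B₃) (hr : 0 < r)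
    (h238 : ∀ K k, ((S K) k).Bound238 (Wk K k) (sp K k) A R)
    (Ec : ℕ → ℕ → Type*) [∀ K k, NormedAddCommGroup (Ec K k)] [∀ K k, NormedSpace ℂ (Ec K k)]
    (ι : letI := θ.instVβ₁; letI := θ.instVβ₂
      (K k : ℕ) → (domSys (F.P K) M (k + 1)).Dom → ((Fin (F.P K).d → Site (F.P K) (k + 1) → θ.Vβ) →L[ℝ] Ec K k))
    (Φ : (K k : ℕ) → (domSys (F.P K) M (k + 1)).Dom → Ec K k → CPair (F.P K) (MatA N))
    (U : (K k : ℕ) → (domSys (F.P K) M (k + 1)).Dom → Set (Ec K k)) (hU : ∀ K k X, IsOpen (U K k X)) (hrU : ∀ K k X, ball (0 : Ec K k) r ⊆ U K k X)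
    (hHhol : ∀ g ∈ Window θ.γ, ∀ (K k : ℕ) (X Z : (domSys (F.P K) M (k + 1)).Dom), Z.1 ⊆ X.1 →
      DifferentiableOn ℂ (fun z => ((S K) k).H (histPrefix g k) (Φ K k X z) Z) (U K k X))
    (hΦemb : letI := θ.instVβ₁; letI := θ.instVβ₂
      ∀ (K k : ℕ) (X : (domSys (F.P K) M (k + 1)).Dom) (B : Fin (F.P K).d → Site (F.P K) (k + 1) → θ.Vβ),
        Φ K k X (ι K k X B) = emb K k (fun l t => NormedSpace.exp (θ.ρ8 (B l t))))
    (hΦsp : ∀ (K k : ℕ) (X : (domSys (F.P K) M (k + 1)).Dom), ∀ z ∈ U K k X, ∀ Z : (domSys (F.P K) M (k + 1)).Dom, Z.1 ⊆ X.1 → Φ K k X z ∈ sp K k Z)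
    (w : (K k : ℕ) → (domSys (F.P K) M (k + 1)).Dom → Site (F.P K) (k + 1) → ℝ) (hw₀ : ∀ K k X t, 0 ≤ w K k X t)
    (hw : letI := θ.instVβ₁; letI := θ.instVβ₂; letI := θ.instιβ
      ∀ (K k : ℕ) (X : (domSys (F.P K) M (k + 1)).Dom) (l : Fin (F.P K).d) (t : Site (F.P K) (k + 1)) (c : θ.ιβ),
        ‖ι K k X (Pi.single l (Pi.single t (θ.bV c)))‖ ≤ w K k X t)
    (htail : ∀ (K k : ℕ) (X : (domSys (F.P K) M (k + 1)).Dom) (t : Site (F.P K) (k + 1)),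
      let e : Site (F.P K) (k + 1) → TPt 4 (domCount (F.P K) M (k + 1) * M) := fun x i => (ZMod.cast (x i) : ZMod (domCount (F.P K) M (k + 1) * M))
      w K k X t ≤ B₃ * Real.exp (-δ₀ * distCT (domCount (F.P K) M (k + 1)) M (e t) (nearT (M := M) (e t) X)))
    (hℓκ : ℓ.κ ≤ delta1 δ₀ κ ((M : ℝ) * 4)) (k : ℕ) :
    ReadOutAt (datumOfRecord₁₃CoPH F N θ hP) (u3OfRecord₁₃ θ.toStage13Params (objectsOfRecord₁₃ F N θ.toStage13Params ℓ) k) :=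
  readOutAt_objectsOfRecord₁₃_coPH θ hP ℓ hs hℓ₀ hcr k
    (kernelDecayOfRecord₁₃_of_activitySlots F N θ.toStage13Params hlim m' M hM S emb hloc Wk hWk sp hA hr₁ hκ hκ₀ hrate hsmall hδ₀ hB₃ hr h238
      Ec ι Φ U hU hrU hHhol hΦemb hΦsp w hw₀ hw htail hℓκ 0 1)

open Classical in
/-- ★★★ **THE (D4) PIN FACE AT A READING PINNED TO THE KERNEL OBJECTS OF RECORD, EVERY RUN LENGTH, FROM ACTIVITY-LEVEL SLOTS + (1.21) EXISTENCE.**  For a Stage-13 rate reading `𝔯`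
whose node-U3 objects at the tuple `(F, θ, hP, g₀, os)` ARE the kernel objects of record (`hpin`, the `U3PinnedKernels` conjunct of K3⁷ v5's `GuardedReadingN16` read at the tuple), a
letter block `ℓ` with its signs, `0 < ℓ.κ ≤ δ₁` and `betaPrime510 4 1 ℓ.κ ≤ ℓ.cr`: the towers∕reading with `Localizes17OfRecord₁₃`, W1's value slot `Bound238` with Road 1's numerals,
the complexified readings with holomorphic activities and exponentially localized site weights and `PolLimitsExistOfRecord₁₃` give
`ReadOutAt (datumOfRecord₁₃CoPH F N θ hP) (rateCarriersOfRecord₁₃CoPH 𝔯 F θ hP g₀ os k).u3` for EVERY `k` — the ACTIVITY-currency twin of dag-n22-w5's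
`readOutAt_rateCarriers_of_kernels_pin_of_printedSlots` (p608801 §3), and the second U3-side conjunct of `KeyedRatesHolderD4`'s body next to (B) §3's
`n22At_rateCarriers_of_kernels_pin_of_activitySlots` (= K3⁷ v5 §2b `readOutAt_rrOfRecord_of_pinned` at the selector's value).  LOCATED (hypothesis form); (D4) NOT discharged. -/
theorem readOutAt_rateCarriers_of_kernels_pin_of_activitySlots (𝔯 : RateReading₁₃CoPH N) (θ : Stage13HParams F N) (hP : θ.Provisos₁₃CoPH F N)
    (g₀ : ℕ → ℝ) (os : List (ULoop F)) (ℓ : U3Letters₁₁) (hs : ℓ.Signs) (hℓ₀ : 0 < ℓ.κ) (hcr : betaPrime510 4 1 ℓ.κ ≤ ℓ.cr)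
    (hpin : (𝔯.lit F θ hP g₀ os).u3 = objectsOfRecord₁₃ F N θ.toStage13Params ℓ)
    (hlim : PolLimitsExistOfRecord₁₃ F N θ.toStage13Params) (m' : ℕ) (M : ℕ) [NeZero M] (hM : M = F.L ^ m')
    (S : (K : ℕ) → ClusterTower (F.P K) (MatA N) M) (emb : ReadingMaps F (MatA N) (MatA N)) (hloc : Localizes17OfRecord₁₃ F N θ.toStage13Params S emb)
    (Wk : (K k : ℕ) → Set (Fin (k + 1) → ℝ)) (hWk : ∀ g ∈ Window θ.γ, ∀ K k, histPrefix g k ∈ Wk K k)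
    (sp : (K k : ℕ) → (domSys (F.P K) M (k + 1)).Dom → Set (CPair (F.P K) (MatA N)))
    {A R r₁ κ δ₀ B₃ r : ℝ}
    (hA : 0 ≤ A) (hr₁ : 0 ≤ r₁) (hκ : κ ≤ r₁) (hκ₀ : kappa₀ (4 * 2 ^ 4) (2 * 4) ≤ κ / 2) (hrate : r₁ + 2 * (64 * Real.log 162) + 2 ≤ R)
    (hsmall : A * Real.exp (5 * r₁ + 1) * K₀ 64 8 * 9 * 64 ≤ 1) (hδ₀ : 0 < δ₀) (hB₃ : 0 ≤ B₃) (hr : 0 < r)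
    (h238 : ∀ K k, ((S K) k).Bound238 (Wk K k) (sp K k) A R)
    (Ec : ℕ → ℕ → Type*) [∀ K k, NormedAddCommGroup (Ec K k)] [∀ K k, NormedSpace ℂ (Ec K k)]
    (ι : letI := θ.instVβ₁; letI := θ.instVβ₂
      (K k : ℕ) → (domSys (F.P K) M (k + 1)).Dom → ((Fin (F.P K).d → Site (F.P K) (k + 1) → θ.Vβ) →L[ℝ] Ec K k))
    (Φ : (K k : ℕ) → (domSys (F.P K) M (k + 1)).Dom → Ec K k → CPair (F.P K) (MatA N))
    (U : (K k : ℕ) → (domSys (F.P K) M (k + 1)).Dom → Set (Ec K k)) (hU : ∀ K k X, IsOpen (U K k X)) (hrU : ∀ K k X, ball (0 : Ec K k) r ⊆ U K k X)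
    (hHhol : ∀ g ∈ Window θ.γ, ∀ (K k : ℕ) (X Z : (domSys (F.P K) M (k + 1)).Dom), Z.1 ⊆ X.1 →
      DifferentiableOn ℂ (fun z => ((S K) k).H (histPrefix g k) (Φ K k X z) Z) (U K k X))
    (hΦemb : letI := θ.instVβ₁; letI := θ.instVβ₂
      ∀ (K k : ℕ) (X : (domSys (F.P K) M (k + 1)).Dom) (B : Fin (F.P K).d → Site (F.P K) (k + 1) → θ.Vβ),
        Φ K k X (ι K k X B) = emb K k (fun l t => NormedSpace.exp (θ.ρ8 (B l t))))
    (hΦsp : ∀ (K k : ℕ) (X : (domSys (F.P K) M (k + 1)).Dom), ∀ z ∈ U K k X, ∀ Z : (domSys (F.P K) M (k + 1)).Dom, Z.1 ⊆ X.1 → Φ K k X z ∈ sp K k Z)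
    (w : (K k : ℕ) → (domSys (F.P K) M (k + 1)).Dom → Site (F.P K) (k + 1) → ℝ) (hw₀ : ∀ K k X t, 0 ≤ w K k X t)
    (hw : letI := θ.instVβ₁; letI := θ.instVβ₂; letI := θ.instιβ
      ∀ (K k : ℕ) (X : (domSys (F.P K) M (k + 1)).Dom) (l : Fin (F.P K).d) (t : Site (F.P K) (k + 1)) (c : θ.ιβ),
        ‖ι K k X (Pi.single l (Pi.single t (θ.bV c)))‖ ≤ w K k X t)
    (htail : ∀ (K k : ℕ) (X : (domSys (F.P K) M (k + 1)).Dom) (t : Site (F.P K) (k + 1)),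
      let e : Site (F.P K) (k + 1) → TPt 4 (domCount (F.P K) M (k + 1) * M) := fun x i => (ZMod.cast (x i) : ZMod (domCount (F.P K) M (k + 1) * M))
      w K k X t ≤ B₃ * Real.exp (-δ₀ * distCT (domCount (F.P K) M (k + 1)) M (e t) (nearT (M := M) (e t) X)))
    (hℓκ : ℓ.κ ≤ delta1 δ₀ κ ((M : ℝ) * 4)) (k : ℕ) :
    ReadOutAt (datumOfRecord₁₃CoPH F N θ hP) (rateCarriersOfRecord₁₃CoPH 𝔯 F θ hP g₀ os k).u3 := by
  show ReadOutAt (datumOfRecord₁₃CoPH F N θ hP) (u3OfRecord₁₃ θ.toStage13Params (𝔯.lit F θ hP g₀ os).u3 k)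
  rw [hpin]
  exact readOutAt_u3OfRecord₁₃_objectsOfRecord₁₃_of_activitySlots F N θ hP ℓ hs hℓ₀ hcr hlim m' M hM S emb hloc Wk hWk sp hA hr₁ hκ hκ₀ hrate hsmall hδ₀ hB₃ hr
    h238 Ec ι Φ U hU hrU hHhol hΦemb hΦsp w hw₀ hw htail hℓκ k

/-! ## §3 BOTH U3-side pin faces of `KeyedRatesHolderD4`'s body — `N22At` and `ReadOutAt` — from ONE copy of the activity-slot antecedent -/

open Classical in
/-- **BOTH U3-SIDE CONJUNCTS (Kf) READS, AT THE OBJECTS OF RECORD, FROM ONE ACTIVITY-SLOT ANTECEDENT**: for a letter block `ℓ` with its signs DOMINATING the engine's constants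
(`0 < ℓ.κ ≤ δ₁`, `C_9·Λ ≤ ℓ.moduli`, `betaPrime510 4 1 ℓ.κ ≤ ℓ.cr`), the towers∕reading with `Localizes17OfRecord₁₃`, W1's TWO activity slots with Road 1's numerals, the complexified
readings with holomorphic activities and the minimizer tails, and `PolLimitsExistOfRecord₁₃` give, for EVERY `k`, the pair
`N22At (u3OfRecord₁₃ θ (objectsOfRecord₁₃ F N θ ℓ) k) ∧ ReadOutAt (datumOfRecord₁₃CoPH F N θ hP) (u3OfRecord₁₃ θ (objectsOfRecord₁₃ F N θ ℓ) k)` — the `h22` input and the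
`ReadOutAt` conjunct of dag-n27-w1's (Kf) `pHolderD4Body_rateCarriers_of_kernels_pin` ∕ `ratesHolderAt_rateCarriers_of_kernels_pin` in ONE theorem ((B) §2
`ne9_EA_objectsOfRecord₁₃_of_activitySlots` + dag-n22-w3's `n22At_u3OfRecord₁₃_objectsOfRecord₁₃_iff`, and §2 above).  LOCATED; N22 ∕ (D4) NOT discharged. -/
theorem u3PinFaces_objectsOfRecord₁₃_of_activitySlots (θ : Stage13HParams F N) (hP : θ.Provisos₁₃CoPH F N) (ℓ : U3Letters₁₁) (hs : ℓ.Signs)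
    (hℓ₀ : 0 < ℓ.κ) (hcr : betaPrime510 4 1 ℓ.κ ≤ ℓ.cr)
    (hlim : PolLimitsExistOfRecord₁₃ F N θ.toStage13Params) (m' : ℕ) (M : ℕ) [NeZero M] (hM : M = F.L ^ m')
    (S : (K : ℕ) → ClusterTower (F.P K) (MatA N) M) (emb : ReadingMaps F (MatA N) (MatA N)) (hloc : Localizes17OfRecord₁₃ F N θ.toStage13Params S emb)
    (Wk : (K k : ℕ) → Set (Fin (k + 1) → ℝ)) (hWk : ∀ g ∈ Window θ.γ, ∀ K k, histPrefix g k ∈ Wk K k)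
    (sp : (K k : ℕ) → (domSys (F.P K) M (k + 1)).Dom → Set (CPair (F.P K) (MatA N)))
    {A R r₁ κ δ₀ B₃ r : ℝ} (Λ : ℕ → ℕ → ℝ)
    (hA : 0 < A) (hr₁ : 0 ≤ r₁) (hκ : κ ≤ r₁) (hκ₀ : kappa₀ (4 * 2 ^ 4) (2 * 4) ≤ κ / 2) (hrate : r₁ + 2 * (64 * Real.log 162) + 2 ≤ R)
    (hsmall : 2 * A * Real.exp (5 * r₁ + 1) * K₀ 64 8 * 9 * 64 ≤ 1) (hΛ : ∀ k i, 0 ≤ Λ k i) (hδ₀ : 0 < δ₀) (hB₃ : 0 ≤ B₃) (hr : 0 < r)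
    (h238 : ∀ K k, ((S K) k).Bound238 (Wk K k) (sp K k) A R)
    (hYL : ∀ K k, ((S K) k).YoungLipschitz (Wk K k) (sp K k) (fun i : Fin (k + 1) => Λ (k + 1) i) R)
    (Ec : ℕ → ℕ → Type*) [∀ K k, NormedAddCommGroup (Ec K k)] [∀ K k, NormedSpace ℂ (Ec K k)]
    (ι : letI := θ.instVβ₁; letI := θ.instVβ₂
      (K k : ℕ) → (domSys (F.P K) M (k + 1)).Dom → ((Fin (F.P K).d → Site (F.P K) (k + 1) → θ.Vβ) →L[ℝ] Ec K k))
    (Φ : (K k : ℕ) → (domSys (F.P K) M (k + 1)).Dom → Ec K k → CPair (F.P K) (MatA N))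
    (U : (K k : ℕ) → (domSys (F.P K) M (k + 1)).Dom → Set (Ec K k)) (hU : ∀ K k X, IsOpen (U K k X)) (hrU : ∀ K k X, ball (0 : Ec K k) r ⊆ U K k X)
    (hHhol : ∀ g ∈ Window θ.γ, ∀ (K k : ℕ) (X Z : (domSys (F.P K) M (k + 1)).Dom), Z.1 ⊆ X.1 →
      DifferentiableOn ℂ (fun z => ((S K) k).H (histPrefix g k) (Φ K k X z) Z) (U K k X))
    (hΦemb : letI := θ.instVβ₁; letI := θ.instVβ₂
      ∀ (K k : ℕ) (X : (domSys (F.P K) M (k + 1)).Dom) (B : Fin (F.P K).d → Site (F.P K) (k + 1) → θ.Vβ),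
        Φ K k X (ι K k X B) = emb K k (fun l t => NormedSpace.exp (θ.ρ8 (B l t))))
    (hΦsp : ∀ (K k : ℕ) (X : (domSys (F.P K) M (k + 1)).Dom), ∀ z ∈ U K k X, ∀ Z : (domSys (F.P K) M (k + 1)).Dom, Z.1 ⊆ X.1 → Φ K k X z ∈ sp K k Z)
    (w : (K k : ℕ) → (domSys (F.P K) M (k + 1)).Dom → Site (F.P K) (k + 1) → ℝ) (hw₀ : ∀ K k X t, 0 ≤ w K k X t)
    (hw : letI := θ.instVβ₁; letI := θ.instVβ₂; letI := θ.instιβ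
      ∀ (K k : ℕ) (X : (domSys (F.P K) M (k + 1)).Dom) (l : Fin (F.P K).d) (t : Site (F.P K) (k + 1)) (c : θ.ιβ),
        ‖ι K k X (Pi.single l (Pi.single t (θ.bV c)))‖ ≤ w K k X t)
    (htail : ∀ (K k : ℕ) (X : (domSys (F.P K) M (k + 1)).Dom) (t : Site (F.P K) (k + 1)),
      let e : Site (F.P K) (k + 1) → TPt 4 (domCount (F.P K) M (k + 1) * M) := fun x i => (ZMod.cast (x i) : ZMod (domCount (F.P K) M (k + 1) * M))
      w K k X t ≤ B₃ * Real.exp (-δ₀ * distCT (domCount (F.P K) M (k + 1)) M (e t) (nearT (M := M) (e t) X)))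
    (hℓκ : ℓ.κ ≤ delta1 δ₀ κ ((M : ℝ) * 4))
    (hdom : ∀ k i, (16 * (8 * (Real.exp 1 * 9 * 64 * K₀ 64 8 ^ 2)) * B₃ ^ 2 / r ^ 2) *
        Real.exp (delta1 δ₀ κ ((M : ℝ) * 4) * ((M : ℝ) * 4) * 3) * K₀ (4 * 2 ^ 4) (2 * 4) * K₁ 4 (δ₀ / 2) * Λ k i ≤ ℓ.moduli k i) (k : ℕ) :
    N22At (u3OfRecord₁₃ θ.toStage13Params (objectsOfRecord₁₃ F N θ.toStage13Params ℓ) k) ∧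
      ReadOutAt (datumOfRecord₁₃CoPH F N θ hP) (u3OfRecord₁₃ θ.toStage13Params (objectsOfRecord₁₃ F N θ.toStage13Params ℓ) k) := by
  have hsmall' : A * Real.exp (5 * r₁ + 1) * K₀ 64 8 * 9 * 64 ≤ 1 := by
    have h0 : 0 ≤ A * Real.exp (5 * r₁ + 1) * K₀ 64 8 * 9 * 64 :=
      mul_nonneg (mul_nonneg (mul_nonneg (mul_nonneg hA.le (Real.exp_pos _).le) (K₀_pos 64 8).le) (by norm_num)) (by norm_num)
    have h2 : 2 * A * Real.exp (5 * r₁ + 1) * K₀ 64 8 * 9 * 64 = 2 * (A * Real.exp (5 * r₁ + 1) * K₀ 64 8 * 9 * 64) := by ring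
    have h3 := hsmall
    rw [h2] at h3
    linarith
  refine ⟨?_, readOutAt_u3OfRecord₁₃_objectsOfRecord₁₃_of_activitySlots F N θ hP ℓ hs hℓ₀ hcr hlim m' M hM S emb hloc Wk hWk sp hA.le hr₁ hκ hκ₀ hrate hsmall'
    hδ₀ hB₃ hr h238 Ec ι Φ U hU hrU hHhol hΦemb hΦsp w hw₀ hw htail hℓκ k⟩
  exact (n22At_u3OfRecord₁₃_objectsOfRecord₁₃_iff F N θ.toStage13Params ℓ hs k).2
    (ne9_EA_objectsOfRecord₁₃_of_activitySlots F N θ.toStage13Params ℓ hs hlim m' M hM S emb hloc Wk hWk sp Λ hA hr₁ hκ hκ₀ hrate hsmall hΛ hδ₀ hB₃ hr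
      h238 hYL Ec ι Φ U hU hrU hHhol hΦemb hΦsp w hw₀ hw htail hℓκ hdom)

open Classical in
/-- **BOTH U3-SIDE PIN FACES AT A PINNED READING, EVERY RUN LENGTH, FROM ONE ACTIVITY-SLOT ANTECEDENT**: under `hpin : (𝔯.lit F θ hP g₀ os).u3 = objectsOfRecord₁₃ F N θ ℓ`, the same
located inputs give `N22At (rateCarriersOfRecord₁₃CoPH 𝔯 F θ hP g₀ os k).u3 ∧ ReadOutAt (datumOfRecord₁₃CoPH F N θ hP) (rateCarriersOfRecord₁₃CoPH 𝔯 F θ hP g₀ os k).u3` for EVERY `k`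
((B) §3 and §2 above; the N22 slot of `RatesHolderAt` and the `ReadOutAt` conjunct of `KeyedRatesHolderD4`'s body at the selector's value).  LOCATED; N22 ∕ (D4) NOT discharged. -/
theorem u3PinFaces_rateCarriers_of_kernels_pin_of_activitySlots (𝔯 : RateReading₁₃CoPH N) (θ : Stage13HParams F N) (hP : θ.Provisos₁₃CoPH F N)
    (g₀ : ℕ → ℝ) (os : List (ULoop F)) (ℓ : U3Letters₁₁) (hs : ℓ.Signs) (hℓ₀ : 0 < ℓ.κ) (hcr : betaPrime510 4 1 ℓ.κ ≤ ℓ.cr)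
    (hpin : (𝔯.lit F θ hP g₀ os).u3 = objectsOfRecord₁₃ F N θ.toStage13Params ℓ)
    (hlim : PolLimitsExistOfRecord₁₃ F N θ.toStage13Params) (m' : ℕ) (M : ℕ) [NeZero M] (hM : M = F.L ^ m')
    (S : (K : ℕ) → ClusterTower (F.P K) (MatA N) M) (emb : ReadingMaps F (MatA N) (MatA N)) (hloc : Localizes17OfRecord₁₃ F N θ.toStage13Params S emb)
    (Wk : (K k : ℕ) → Set (Fin (k + 1) → ℝ)) (hWk : ∀ g ∈ Window θ.γ, ∀ K k, histPrefix g k ∈ Wk K k)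
    (sp : (K k : ℕ) → (domSys (F.P K) M (k + 1)).Dom → Set (CPair (F.P K) (MatA N)))
    {A R r₁ κ δ₀ B₃ r : ℝ} (Λ : ℕ → ℕ → ℝ)
    (hA : 0 < A) (hr₁ : 0 ≤ r₁) (hκ : κ ≤ r₁) (hκ₀ : kappa₀ (4 * 2 ^ 4) (2 * 4) ≤ κ / 2) (hrate : r₁ + 2 * (64 * Real.log 162) + 2 ≤ R)
    (hsmall : 2 * A * Real.exp (5 * r₁ + 1) * K₀ 64 8 * 9 * 64 ≤ 1) (hΛ : ∀ k i, 0 ≤ Λ k i) (hδ₀ : 0 < δ₀) (hB₃ : 0 ≤ B₃) (hr : 0 < r)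
    (h238 : ∀ K k, ((S K) k).Bound238 (Wk K k) (sp K k) A R)
    (hYL : ∀ K k, ((S K) k).YoungLipschitz (Wk K k) (sp K k) (fun i : Fin (k + 1) => Λ (k + 1) i) R)
    (Ec : ℕ → ℕ → Type*) [∀ K k, NormedAddCommGroup (Ec K k)] [∀ K k, NormedSpace ℂ (Ec K k)]
    (ι : letI := θ.instVβ₁; letI := θ.instVβ₂
      (K k : ℕ) → (domSys (F.P K) M (k + 1)).Dom → ((Fin (F.P K).d → Site (F.P K) (k + 1) → θ.Vβ) →L[ℝ] Ec K k))
    (Φ : (K k : ℕ) → (domSys (F.P K) M (k + 1)).Dom → Ec K k → CPair (F.P K) (MatA N))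
    (U : (K k : ℕ) → (domSys (F.P K) M (k + 1)).Dom → Set (Ec K k)) (hU : ∀ K k X, IsOpen (U K k X)) (hrU : ∀ K k X, ball (0 : Ec K k) r ⊆ U K k X)
    (hHhol : ∀ g ∈ Window θ.γ, ∀ (K k : ℕ) (X Z : (domSys (F.P K) M (k + 1)).Dom), Z.1 ⊆ X.1 →
      DifferentiableOn ℂ (fun z => ((S K) k).H (histPrefix g k) (Φ K k X z) Z) (U K k X))
    (hΦemb : letI := θ.instVβ₁; letI := θ.instVβ₂
      ∀ (K k : ℕ) (X : (domSys (F.P K) M (k + 1)).Dom) (B : Fin (F.P K).d → Site (F.P K) (k + 1) → θ.Vβ),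
        Φ K k X (ι K k X B) = emb K k (fun l t => NormedSpace.exp (θ.ρ8 (B l t))))
    (hΦsp : ∀ (K k : ℕ) (X : (domSys (F.P K) M (k + 1)).Dom), ∀ z ∈ U K k X, ∀ Z : (domSys (F.P K) M (k + 1)).Dom, Z.1 ⊆ X.1 → Φ K k X z ∈ sp K k Z)
    (w : (K k : ℕ) → (domSys (F.P K) M (k + 1)).Dom → Site (F.P K) (k + 1) → ℝ) (hw₀ : ∀ K k X t, 0 ≤ w K k X t)
    (hw : letI := θ.instVβ₁; letI := θ.instVβ₂; letI := θ.instιβ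
      ∀ (K k : ℕ) (X : (domSys (F.P K) M (k + 1)).Dom) (l : Fin (F.P K).d) (t : Site (F.P K) (k + 1)) (c : θ.ιβ),
        ‖ι K k X (Pi.single l (Pi.single t (θ.bV c)))‖ ≤ w K k X t)
    (htail : ∀ (K k : ℕ) (X : (domSys (F.P K) M (k + 1)).Dom) (t : Site (F.P K) (k + 1)),
      let e : Site (F.P K) (k + 1) → TPt 4 (domCount (F.P K) M (k + 1) * M) := fun x i => (ZMod.cast (x i) : ZMod (domCount (F.P K) M (k + 1) * M))
      w K k X t ≤ B₃ * Real.exp (-δ₀ * distCT (domCount (F.P K) M (k + 1)) M (e t) (nearT (M := M) (e t) X)))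
    (hℓκ : ℓ.κ ≤ delta1 δ₀ κ ((M : ℝ) * 4))
    (hdom : ∀ k i, (16 * (8 * (Real.exp 1 * 9 * 64 * K₀ 64 8 ^ 2)) * B₃ ^ 2 / r ^ 2) *
        Real.exp (delta1 δ₀ κ ((M : ℝ) * 4) * ((M : ℝ) * 4) * 3) * K₀ (4 * 2 ^ 4) (2 * 4) * K₁ 4 (δ₀ / 2) * Λ k i ≤ ℓ.moduli k i) (k : ℕ) :
    N22At (rateCarriersOfRecord₁₃CoPH 𝔯 F θ hP g₀ os k).u3 ∧ ReadOutAt (datumOfRecord₁₃CoPH F N θ hP) (rateCarriersOfRecord₁₃CoPH 𝔯 F θ hP g₀ os k).u3 := by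
  show N22At (u3OfRecord₁₃ θ.toStage13Params (𝔯.lit F θ hP g₀ os).u3 k) ∧
    ReadOutAt (datumOfRecord₁₃CoPH F N θ hP) (u3OfRecord₁₃ θ.toStage13Params (𝔯.lit F θ hP g₀ os).u3 k)
  rw [hpin]
  exact u3PinFaces_objectsOfRecord₁₃_of_activitySlots F N θ hP ℓ hs hℓ₀ hcr hlim m' M hM S emb hloc Wk hWk sp Λ hA hr₁ hκ hκ₀ hrate hsmall hΛ hδ₀ hB₃ hr h238 hYL
    Ec ι Φ U hU hrU hHhol hΦemb hΦsp w hw₀ hw htail hℓκ hdom k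

end YMDAG.N22.WindowSoftTwoPoint

end
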